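import Literature.AnabelianGeometry.SemiGraphs.TemperedPiCharacteristicTowerOfCharCores
import Literature.AnabelianGeometry.SemiGraphs.TemperedPiCompactOfNoClosedEdge
import HarnessLib

/-!
# The characteristic André tower of `π₁^temp(𝒢)` exists IFF `𝔾` has a closed edge — tightness of the
# leaf (L-B1′) of the Ex. 3.10 bridge ([SemiAnbd] Prop. 3.6 p. 38, §1 p. 12; [André 2003] §4.5)

Mochizuki, *Semi-graphs of anabelioids*, Publ. RIMS **42** (2006) [SemiAnbd], Prop. 3.6 p. 38, §1 p. 12
(closed / open edges), Ex. 3.10 pp. 44–45. [cite: MochizukiSemiAnbd2006, Prop 3.6 p.38]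

PROOF-ONLY file (abc-iut cell, prover abc-iut-w5-d240; no definitions, no instances, no named facts).
`TemperedPiCharacteristicTowerOfCharCores.lean` (p452583) supplies the leaf (L-B1′) of the Ex. 3.10
bridge — a CHARACTERISTIC André tower at every level chart `π₁^temp(𝒢_i)` — for finite fibres with
topologically finitely generated constituents and a CLOSED EDGE.  This file records that the closed edge
is NECESSARY, so that the leaf is exactly characterised (and a special-fibre tower feeding the bridge
must start at a level with singular reduction):

* `not_charTower_of_compactSpace` — a compact group has no characteristic André tower (indeed no André
  tower at all, `not_tower_of_compactSpace`);
* `TemperedPiChart.exists_isClosedEdge_of_charTower` — a characteristic André tower at a chart of a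
  finite `𝒢` (Prop. 3.6 hypotheses) forces a closed edge of `𝔾` (otherwise the chart is compact,
  `TemperedPiChart.compactSpace_of_forall_not_isClosedEdge`, p444396);
* `TemperedPiChart.charTower_iff_exists_isClosedEdge` — **for finite `𝒢` with topologically finitely
  generated constituents: characteristic André tower ⟺ closed edge** (⇐ p452583);
* `SpecialFibreTower.exists_isClosedEdge_of_hch` — at a special-fibre tower, the bridge's binder `hch`
  at a finite level `i` forces a closed edge of `𝔾_i`.

Classical; nothing here bears on [IUTchIII] Cor. 3.12 or takes a side on any disputed claim.
-/

noncomputable section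

namespace Literature.AnabelianGeometry.SemiGraphs

open _root_.Topology
open Literature.AnabelianGeometry.AbsoluteAnabelian (IsTopologicallyFinitelyGenerated)

universe u

/-! ### 1. Compact groups -/

/-- **A compact topological group has no characteristic André tower** (it has no André tower at all:
an open normal subgroup has finite quotient, `not_tower_of_compactSpace`).
[cite: MochizukiSemiAnbd2006, Prop 3.6 p.38] -/
theorem not_charTower_of_compactSpace {P : Type u} [Group P] [TopologicalSpace P] [IsTopologicalGroup P]
    [CompactSpace P] :
    ¬ (∀ V ∈ 𝓝 (1 : P), ∃ M : OpenNormalSubgroup P, (M : Set P) ⊆ V ∧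
      (∀ φ : P ≃ₜ* P, M.toSubgroup.map φ.toMulEquiv.toMonoidHom ≤ M.toSubgroup) ∧
      ∃ (G : Subgroup (P ⧸ M.toSubgroup)) (_ : IsFreeGroup G), G.FiniteIndex ∧
        Finite (IsFreeGroup.Generators G) ∧ ∃ a ∈ G, ∃ b ∈ G, a * b ≠ b * a) := by
  intro h
  refine not_tower_of_compactSpace (P := P) fun U hU => ?_
  obtain ⟨M, hMU, -, G, hG, hGfi, hGfin, hab⟩ := h U hU
  haveI := hGfi
  obtain ⟨G', hG', hG'n, hG'fi, hG'fin, hab'⟩ := exists_free_normal_of_free_finiteIndex G hG hGfin hab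
  exact ⟨M, hMU, G', hG', hG'n, hG'fi, hG'fin, hab'⟩

namespace ProfiniteSemiGraph

variable {𝒢 : ProfiniteSemiGraph.{u}} (c : TemperedPiChart 𝒢)

/-! ### 2. Charts: characteristic André tower ⟺ closed edge -/

/-- **A characteristic André tower at a chart forces a closed edge** (`𝒢` finite, Prop. 3.6
hypotheses): with no closed edge every chart is compact (`compactSpace_of_forall_not_isClosedEdge`).
[cite: MochizukiSemiAnbd2006, Prop 3.6 p.38] -/
theorem TemperedPiChart.exists_isClosedEdge_of_charTower (h36 : 𝒢.Prop36Hypotheses)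
    [Finite 𝒢.graph.Vertex] [Finite 𝒢.graph.Edge]
    (h : ∀ V ∈ 𝓝 (1 : c.G), ∃ M : OpenNormalSubgroup c.G, (M : Set c.G) ⊆ V ∧
      (∀ φ : c.G ≃ₜ* c.G, M.toSubgroup.map φ.toMulEquiv.toMonoidHom ≤ M.toSubgroup) ∧
      ∃ (G : Subgroup (c.G ⧸ M.toSubgroup)) (_ : IsFreeGroup G), G.FiniteIndex ∧
        Finite (IsFreeGroup.Generators G) ∧ ∃ a ∈ G, ∃ b ∈ G, a * b ≠ b * a) :
    ∃ e : 𝒢.graph.Edge, 𝒢.graph.IsClosedEdge e := by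
  by_contra hne
  push Not at hne
  haveI := c.compactSpace_of_forall_not_isClosedEdge h36 hne
  exact not_charTower_of_compactSpace h

/-- **Characteristic André tower ⟺ closed edge**, for every chart of a finite semi-graph of
anabelioids satisfying the hypotheses of Prop. 3.6 with topologically finitely generated constituents
(⇐: `TemperedPiChart.charTower`; ⇒: compactness without closed edges).  The leaf (L-B1′) of the
Ex. 3.10 bridge is thus EXACTLY characterised. [cite: MochizukiSemiAnbd2006, Prop 3.6 p.38] -/
theorem TemperedPiChart.charTower_iff_exists_isClosedEdge (h36 : 𝒢.Prop36Hypotheses)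
    [Finite 𝒢.graph.Vertex] [Finite 𝒢.graph.Edge]
    (hVt : ∀ v : 𝒢.graph.Vertex, IsTopologicallyFinitelyGenerated (𝒢.Gv v))
    (hEt : ∀ e : 𝒢.graph.Edge, IsTopologicallyFinitelyGenerated (𝒢.Ge e)) :
    (∀ V ∈ 𝓝 (1 : c.G), ∃ M : OpenNormalSubgroup c.G, (M : Set c.G) ⊆ V ∧
      (∀ φ : c.G ≃ₜ* c.G, M.toSubgroup.map φ.toMulEquiv.toMonoidHom ≤ M.toSubgroup) ∧
      ∃ (G : Subgroup (c.G ⧸ M.toSubgroup)) (_ : IsFreeGroup G), G.FiniteIndex ∧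
        Finite (IsFreeGroup.Generators G) ∧ ∃ a ∈ G, ∃ b ∈ G, a * b ≠ b * a) ↔
    ∃ e : 𝒢.graph.Edge, 𝒢.graph.IsClosedEdge e := by
  haveI : Finite 𝒢.graph.Branch := SemiGraph.finite_branch 𝒢.graph
  refine ⟨c.exists_isClosedEdge_of_charTower h36, fun hcl V hV => ?_⟩
  obtain ⟨M, hMV, hchar, G, hG, -, hGfi, hGfin, hab⟩ := c.charTower h36 hVt hEt hcl V hV
  exact ⟨M, hMV, hchar, G, hG, hGfi, hGfin, hab⟩

/-- The same with COHERENCE (Def. 2.3 (iii)) in place of the two finite-generation hypotheses.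
[cite: MochizukiSemiAnbd2006, Prop 3.6 p.38] -/
theorem TemperedPiChart.charTower_iff_exists_isClosedEdge_of_coherent (h36 : 𝒢.Prop36Hypotheses)
    [Finite 𝒢.graph.Vertex] [Finite 𝒢.graph.Edge] (hcoh : 𝒢.IsCoherent) :
    (∀ V ∈ 𝓝 (1 : c.G), ∃ M : OpenNormalSubgroup c.G, (M : Set c.G) ⊆ V ∧
      (∀ φ : c.G ≃ₜ* c.G, M.toSubgroup.map φ.toMulEquiv.toMonoidHom ≤ M.toSubgroup) ∧
      ∃ (G : Subgroup (c.G ⧸ M.toSubgroup)) (_ : IsFreeGroup G), G.FiniteIndex ∧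
        Finite (IsFreeGroup.Generators G) ∧ ∃ a ∈ G, ∃ b ∈ G, a * b ≠ b * a) ↔
    ∃ e : 𝒢.graph.Edge, 𝒢.graph.IsClosedEdge e :=
  c.charTower_iff_exists_isClosedEdge h36 (fun v => ⟨hcoh.2.1 v⟩) (fun e => ⟨hcoh.2.2 e⟩)

end ProfiniteSemiGraph

/-! ### 3. At a special-fibre tower -/

/-- **At a special-fibre tower, the bridge's leaf (L-B1′) at a finite level forces a closed edge of
that level's dual semi-graph**: a level with smooth reduction (one vertex carrying cusps, no closed
edge) cannot carry the binder `hch` of `TemperedCurve.tower_of_specialFibreTower` — the tower is to be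
started at a level with singular reduction. [cite: MochizukiSemiAnbd2006, Ex 3.10 pp.44-45] -/
theorem SpecialFibreTower.exists_isClosedEdge_of_hch {Δ : Type u} [Group Δ] [TopologicalSpace Δ]
    (T : SpecialFibreTower Δ) (i : ℕ) [Finite (T.Gc i).graph.Vertex] [Finite (T.Gc i).graph.Edge]
    (hch : ∀ V ∈ 𝓝 (1 : (T.chart i).G), ∃ MQ : OpenNormalSubgroup (T.chart i).G,
      (MQ : Set (T.chart i).G) ⊆ V ∧
      (∀ φ : (T.chart i).G ≃ₜ* (T.chart i).G,
        MQ.toSubgroup.map φ.toMulEquiv.toMonoidHom ≤ MQ.toSubgroup) ∧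
      ∃ (G : Subgroup ((T.chart i).G ⧸ MQ.toSubgroup)) (_ : IsFreeGroup G), G.FiniteIndex ∧
        Finite (IsFreeGroup.Generators G) ∧ ∃ a ∈ G, ∃ b ∈ G, a * b ≠ b * a) :
    ∃ e : (T.Gc i).graph.Edge, (T.Gc i).graph.IsClosedEdge e :=
  (T.chart i).exists_isClosedEdge_of_charTower (T.hyp i).toProp36Hypotheses hch

end Literature.AnabelianGeometry.SemiGraphs

end
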